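import Summits.QuantumFields.YangMills.Theorems.BalabanUVNodesN22W1StripLastTermwise
import Summits.QuantumFields.YangMills.Theorems.BalabanUVNodesN22AtW1Reading13

/-!
# BalabanUVNodes ∕ node N22 = NE9 — THE STRIP INDUCTION AT THE W1 OBJECT, MODULE 23′: THE STAGE-13 TWINS OF THE θ-FORM LEAVES — the edge N18 → N22 of the s1 line
# at ANY Stage-13 rate reading `𝔯 : RateReading₁₃ N` PINNED at the admissible W1 reading of record on the towers of the runs of record (dag-n22-e g5's `hpin` pattern,
# `…N22AtW1Reading13`), in the three currencies of modules 15′ (level-T hypothesis universal in the domain + node N09's `EHoloAt` family), 19′ (three per-step generator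
# schemas) and 21′ (all analytic inputs at term level)

Cell `pub-ymgap`, HUMAN RULING D-0062 (Track A), R134 ACCELERATION re-seat `pub-ymgap-dag-n22-c` (strategy s1), generation 5, module 23′ (the author's Stage-13 twin of its
own ₁₂ leaves, chair R426).  THEOREMS ONLY; imports module 21′ `…N22W1StripLastTermwise` (transitively 15′ ∕ 19′ ∕ 20′: the θ-PARAMETRIC engines
`n22At_u3OfRecord₁₂_ofRecordAdm_runTowers_of_n18Below_termwise226OnOlder_eHoloAt`, `…_toClusterTower_of_n18Below_threeSchemas`, `stepSchema226_of_termwise`,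
`stepSchemaLast_of_termwiseIdx`) and dag-n22-e g5's module 9″c `…N22AtW1Reading13` (`YMDAG.N22.s_N22_rRec₁₃_w1_iff`; transitively layer B ₁₃ `s_N18_rRec₁₃_iff`,
`u3OfRecord₁₃_eq_u3OfRecord₁₂`) BY NAME.  `--supports` K3‴ `SpineGivenEndpointR13` (stmt-QuantumFields-19912) as a helper (dag-lead WORDS-133 ∕ DEDUP-249 (B) one map).

WHY.  The route's items were re-keyed 12 ↦ 13 (`Node00.Stage13Params extends Stage12Params`, `IsDatumOfRecord₁₃C`, n22-e's `RRec₁₃`).  The s1 line's θ-free engines take the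
Stage-12 tuple ONLY through `θ.γ` and the bundle `u3OfRecord₁₂ θ`, and n22-e's bridge `u3OfRecord₁₃ θ u k = u3OfRecord₁₂ θ.toStage12Params u k` is `rfl` — so each ₁₂ leaf has a
Stage-13 twin by ONE instantiation at `θ.toStage12Params`.  Stated for EVERY Stage-13 reading whose node-U3 objects are the admissible W1 reading's (`hpin`, one pointwise
equation; `rfl` at n22-e's reading of record `readingOfRecord₁₃ w1 ℓ₃ ne2 ne1` and at RR-2's `RateAssignment₁₃` lifts), so no edition of the ₁₃ reading is anticipated here.

WHAT (all at `w1 F θ := ReadingData.ofRecordAdm F θ.τ9.M N (runTowers (S₀ F θ)) (sp F θ) (gauge F θ) (hg F θ) (T₀ F θ) (hT F θ) (li F θ)` over `θ : Stage13Params F N`).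
* §0 `n18At_u3OfRecord₁₃_of_s_N18_rRec₁₃_pin` — node N18's stub at a pinned reading, read per datum key and level (layer B's `s_N18_rRec₁₃_iff` + `hpin`).
* §1 `s_N22_rRec₁₃_pin_ofRecordAdm_runTowers_of_s_N18_termwise226OnOlder_eHoloAt` — 15′ §4's twin (arbitrary towers `S₀ F θ k`; OLDER-coupling level-T hypothesis universal
  in the domain + the `EHoloAt` family below the run length).
* §2 `s_N22_rRec₁₃_pin_ofRecordAdm_runTowers_toClusterTower_of_s_N18_threeSchemas` — 19′ §4's twin (generated towers; (S-loc) + (S-226) + (S-last)).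
* §3 ★ `s_N22_rRec₁₃_pin_ofRecordAdm_runTowers_toClusterTower_of_s_N18_allTermwise` — 21′ §3's twin (generated towers; (S-loc) + index maps + (S-226-T) + (S-last-T)).

HONEST FRAMING.  Count-neutral by-name knits (sed-level twins + one `rfl` bridge); NOT a discharge of N22: every analytic input is a DISPLAYED hypothesis with no producer at a
reading of record today; `S_N18` is node N18's stub; no inhabitant of `IsDatumOfRecord₁₃C` claimed (K0‴ `Record13Inhabited`, stmt-QuantumFields-19909, OPEN); statements at
`ofRecordAdm` vacuous where `AdmBg … k = ∅` (21′ §4 names the inhabited case).  NE9 NOT IN PRINT for d = 4; one finite four-torus programme at fixed ε — NOT infinite volume, NOT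
OS on ℝ⁴, NOT a mass gap, NOT Clay.  0 `sorry`, 0 `def`, standard axioms.

References (TYPES only): [I] = [Balaban1987RG1] (0.23)–(0.25) pp. 256–257, §1 p. 263, (2.12)–(2.13) p. 268; [II] = [Balaban1988RG2Cluster] (2.13)–(2.15) pp. 14–15,
(2.26) p. 17, Lemma 3 p. 20, (2.40)–(2.41) p. 21.
-/

noncomputable section

open scoped Matrix.Norms.L2Operator

namespace YMDAG.N22.W1

open Set Metric
open scoped BigOperators
open Literature.MathematicalPhysics.QuantumFieldTheory.Balaban1983to89
open Literature.MathematicalPhysics.QuantumFieldTheory.Balaban1983to89.T4Continuum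
open Literature.MathematicalPhysics.QuantumFieldTheory.Balaban1983to89.T4OutputRate
open Literature.MathematicalPhysics.QuantumFieldTheory.Balaban1983to89.TreeLengthTorus (TPt TDom tsys torusTreeLen torusTreeLen_nonneg)
open Literature.MathematicalPhysics.QuantumFieldTheory.Balaban1983to89.B12TreeDecay (K₀ K₀_pos)
open Literature.MathematicalPhysics.QuantumFieldTheory.Balaban1983to89.B13Lemma3TorusData (TBond)
open Literature.MathematicalPhysics.QuantumFieldTheory.Balaban1983to89.B13Lemma3TorusTerms (terms weight weight_nonneg)
open Literature.MathematicalPhysics.QuantumFieldTheory.Balaban1983to89.B13Lemma3TorusSocket (Lemma3Numerics)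
open Literature.MathematicalPhysics.QuantumFieldTheory.Balaban1983to89.B12BetaHolo (EHoloAt)
open Literature.MathematicalPhysics.QuantumFieldTheory.Balaban1983to89.Step (SFConsts)
open Literature.MathematicalPhysics.QuantumFieldTheory.Balaban1983to89.Node00
  (Stage13Params IsDatumOfRecord₁₃C U3Objects₁₁ U3Letters₁₁ MatA ιSU prependCoupling)
open Literature.MathematicalPhysics.QuantumFieldTheory.Balaban1983to89.Node00.Sect2 (domSys domCount CPair ofBackgroundC spaceI domSites Setting Residual)
open Literature.MathematicalPhysics.QuantumFieldTheory.Balaban1983to89.Node00.W1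
open YMDAG.UVSplit

variable {N : ℕ} [NeZero N] (𝔯 : RateReading₁₃ N)

/-! ## §0 Node N18's stub at a pinned Stage-13 reading, per datum key and level -/

section PinnedN18

variable (w1 : (F : T4Family) → (θ : Stage13Params F N) → ReadingData F (MatA N) θ.τ9.M)

/-- **`S_N18 (RRec₁₃ 𝔯)` AT A W1-PINNED STAGE-13 READING GIVES `N18At` AT EVERY DATUM KEY AND LEVEL of W1's node-U3 objects** (layer B's `s_N18_rRec₁₃_iff` at `g₀ := 0`,
`os := []`, rewritten along `hpin`). [cite: Balaban1987RG1, (0.23)-(0.25) pp.256-257 (bookkeeping)] -/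
theorem n18At_u3OfRecord₁₃_of_s_N18_rRec₁₃_pin
    (hpin : ∀ (F : T4Family) (θ : Stage13Params F N) (hP : θ.Provisos₁₃ F N) (g₀ : ℕ → ℝ) (os : List (ULoop F)), (𝔯.lit F θ hP g₀ os).u3 = (w1 F θ).u3Objects θ.γ)
    (h18 : S_N18 (RRec₁₃ 𝔯)) (F : T4Family) (D : Datum F N) (h : IsDatumOfRecord₁₃C F N D) (k : ℕ) :
    N18At (u3OfRecord₁₃ h.params ((w1 F h.params).u3Objects h.params.γ) k) := by
  have := (s_N18_rRec₁₃_iff 𝔯).1 h18 F D h (fun _ => 0) [] k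
  rwa [hpin] at this

end PinnedN18

/-! ## §1 Twin of 15′ §4: arbitrary towers, OLDER-coupling level-T hypothesis universal in the domain + node N09's `EHoloAt` family below the run length -/

section TowersEdge

variable (S₀ : (F : T4Family) → (θ : Stage13Params F N) → (k : ℕ) → ClusterTower (F.P k) (MatA N) θ.τ9.M)
  (sp : (F : T4Family) → (θ : Stage13Params F N) → (k j : ℕ) → (domSys (F.P k) θ.τ9.M j).Dom → Set (CPair (F.P k) (MatA N)))
  (gauge : (F : T4Family) → (θ : Stage13Params F N) → (k : ℕ) → GaugeField (F.P k) 0 (Node00.SU N) → GaugeField (F.P k) 0 (Node00.SU N) → ℝ)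
  (hg : ∀ (F : T4Family) (θ : Stage13Params F N) (k : ℕ) (U U' : GaugeField (F.P k) 0 (Node00.SU N)), 0 ≤ gauge F θ k U U')
  (T₀ : (F : T4Family) → (θ : Stage13Params F N) → (k : ℕ) → GaugeField (F.P (k + 1)) 0 (Node00.SU N) → GaugeField (F.P k) 0 (Node00.SU N))
  (hT : ∀ (F : T4Family) (θ : Stage13Params F N) (k : ℕ) (U : GaugeField (F.P (k + 1)) 0 (Node00.SU N)),
    (∀ (j : ℕ) (Y : (domSys (F.P (k + 1)) θ.τ9.M j).Dom), ofBackgroundC (ιSU N) U ∈ sp F θ (k + 1) j Y) →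
      ∀ (j : ℕ) (X : (domSys (F.P k) θ.τ9.M j).Dom), ofBackgroundC (ιSU N) (T₀ F θ k U) ∈ sp F θ k j X)
  (li : (F : T4Family) → Stage13Params F N → LetterInputs) {G : Type*} [GaugeGroup G]

open Classical in
/-- **STAGE-13 TWIN OF 15′ §4 — THE EDGE N18 → N22 AT A READING PINNED AT THE ADMISSIBLE READING OF RECORD ON THE TOWERS OF THE RUNS OF RECORD**: node N18's stub
`S_N18 (RRec₁₃ 𝔯)` + the letter signs + per `(F, θ, k)` ∃(`NeZero θ.τ9.M`, `Sg`, `Rz`, `logZ`, `β`, `cs`, `c`, `L`, `NeZero L`, `a … r₁`): `hspk` ∧ numerals ∧ `θ.γ ≤ cs.γ` ∧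
`li.κ ≤ cs.κ` ∧ the OLDER-coupling level-T hypothesis UNIVERSAL IN THE DOMAIN on `S₀ F θ k` below the run length (node N10's lane) ∧ the `EHoloAt` family on
`sfTowerOfRecord Sg Rz θ.τ9.M (S₀ F θ k) ⟨g, β⟩ logZ` below the run length (node N09's currency) ⟹ node N22's stub `S_N22 (RRec₁₃ 𝔯)` — 15′ §3's engine at `θ.toStage12Params`.
[cite: Balaban1987RG1, (0.23)-(0.25) pp.256-257, Thm 1 p.259 and (1.18) p.263; Balaban1988RG2Cluster, (2.13)-(2.14) pp.14-15, (2.26) p.17 and (2.40)-(2.41) p.21] -/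
theorem s_N22_rRec₁₃_pin_ofRecordAdm_runTowers_of_s_N18_termwise226OnOlder_eHoloAt
    (hpin : ∀ (F : T4Family) (θ : Stage13Params F N) (hP : θ.Provisos₁₃ F N) (g₀ : ℕ → ℝ) (os : List (ULoop F)), (𝔯.lit F θ hP g₀ os).u3 =
      (ReadingData.ofRecordAdm F θ.τ9.M N (runTowers (S₀ F θ)) (sp F θ) (gauge F θ) (hg F θ) (T₀ F θ) (hT F θ) (li F θ)).u3Objects θ.γ)
    (h18 : S_N18 (RRec₁₃ 𝔯))
    (hnum : ∀ (F : T4Family) (θ : Stage13Params F N), θ.Provisos₁₃ F N → θ.Admissible F N →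
      0 < (li F θ).C₀ ∧ 0 < (li F θ).θ₅ ∧ (li F θ).θ₅ < 1 ∧ 0 ≤ (li F θ).C₅ ∧ 2 * (li F θ).C₅ / (1 - (li F θ).θ₅) ≤ (li F θ).C₀ ∧ 0 < (li F θ).A ∧
        (li F θ).θ₅ ≤ (li F θ).μ ∧ (li F θ).C₀ ≤ 2 * (li F θ).A ∧ 0 < (li F θ).r ∧ 0 < (li F θ).s ∧ (li F θ).s < 1 ∧ 1 ≤ (li F θ).μ)
    (hdata : ∀ (F : T4Family) (θ : Stage13Params F N), θ.Provisos₁₃ F N → θ.Admissible F N → ∀ (k : ℕ),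
      ∃ (_ : NeZero θ.τ9.M) (Sg : Setting (MatA N) G) (Rz : Residual (F.P k) (MatA N)) (logZ : ℕ → GaugeField (F.P k) 0 G → ℝ) (β : ℕ → ℝ → ℝ)
        (cs : SFConsts) (c : B13.Consts) (L : ℕ) (_ : NeZero L) (a a₂ a₂' a₅ Aabs r₁ : ℝ),
        (∀ (j : ℕ) (Y : (domSys (F.P k) θ.τ9.M j).Dom), sp F θ k j Y ⊆ spaceI Sg Rz θ.τ9.M j (domSites (F.P k) θ.τ9.M j Y) cs.α₀ cs.α₁) ∧
        8 ≤ c.L ∧ c.L = L ∧ Lemma3Numerics c θ.τ9.M ((c.L : ℝ) / 2) a a₂ a₂' a₅ Aabs ∧ 0 ≤ c.C3act * c.ε₁ ∧ 0 ≤ r₁ ∧ (li F θ).κ ≤ r₁ ∧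
        r₁ + 2 * (64 * Real.log 162) + 2 ≤ (1 - 8 * c.δ) * ((c.L : ℝ) / 2) * c.κ ∧
        c.C3act * c.ε₁ * Real.exp (5 * r₁ + 1) * K₀ 64 8 * 9 * 64 ≤ 1 ∧
        Real.exp 1 * 9 * 64 * K₀ 64 8 ^ 2 * (c.C3act * c.ε₁) ≤ (li F θ).A ∧ θ.γ ≤ cs.γ ∧ (li F θ).κ ≤ cs.κ ∧
        (∀ (Dm : Set ℂ), IsOpen Dm → (∀ t ∈ Ioc (0 : ℝ) θ.γ, closedBall (t : ℂ) (li F θ).r ⊆ Dm) →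
          ∀ (k' : ℕ), k' < k → ∀ (g : ℕ → ℝ), g ∈ Window θ.γ → ∀ (i : ℕ), i < k' →
          ∀ (X : (domSys (F.P k) θ.τ9.M (k' + 1)).Dom) (φ : CPair (F.P k) (MatA N)),
          φ ∈ spaceI Sg Rz θ.τ9.M (k' + 1) (domSites (F.P k) θ.τ9.M (k' + 1) X) cs.α₀ cs.α₁ →
          (∀ (j : ℕ), j < k' + 1 → ∀ (Y : (domSys (F.P k) θ.τ9.M j).Dom) (ψ : CPair (F.P k) (MatA N)),
            ψ ∈ spaceI Sg Rz θ.τ9.M j (domSites (F.P k) θ.τ9.M j Y) cs.α₀ cs.α₁ →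
            ∃ Ec : ℂ → ℂ, DifferentiableOn ℂ Ec Dm ∧ (∀ z ∈ Dm, ‖Ec z‖ ≤ (li F θ).A * Real.exp (-((li F θ).κ * torusTreeLen Y.1))) ∧
              (∀ t ∈ Ioc (0 : ℝ) θ.γ, Ec t = termC (S₀ F θ k) j Y (Function.update g i t) ψ)) →
          ∃ (Hc : ℂ → TDom 4 (domCount (F.P k) θ.τ9.M (k' + 1)) → ℂ)
            (Tt : (Z : TDom 4 (domCount (F.P k) θ.τ9.M (k' + 1))) →
              Finset (TDom 4 (L * domCount (F.P k) θ.τ9.M (k' + 1))) × Finset (TBond 4 θ.τ9.M (L * domCount (F.P k) θ.τ9.M (k' + 1))) → ℂ → ℂ),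
            (∀ Z : (domSys (F.P k) θ.τ9.M (k' + 1)).Dom, Z.1 ⊆ X.1 → DifferentiableOn ℂ (fun z => Hc z Z) Dm) ∧
            (∀ z ∈ Dm, ∀ Z : TDom 4 (domCount (F.P k) θ.τ9.M (k' + 1)), Z.1 ⊆ X.1 → ‖Hc z Z‖ ≤ ∑ t ∈ terms L θ.τ9.M Z, ‖Tt Z t z‖) ∧
            (∀ z ∈ Dm, ∀ Z : TDom 4 (domCount (F.P k) θ.τ9.M (k' + 1)), Z.1 ⊆ X.1 → ∀ t ∈ terms L θ.τ9.M Z,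
              ‖Tt Z t z‖ ≤ weight L θ.τ9.M c Z a t * Real.exp (a₅ * ((Z.1).card : ℝ))) ∧
            (∀ t ∈ Ioc (0 : ℝ) θ.γ, Hc t = ((S₀ F θ k) k').H (restrictPrefix k' (Function.update g i t)) φ)) ∧
        (∀ g ∈ Window θ.γ, ∀ k' : ℕ, k' + 1 ≤ k →
          ∃ H : EHoloAt (sfTowerOfRecord Sg Rz θ.τ9.M (S₀ F θ k) ⟨g, β⟩ logZ) cs k', H.E₀ ≤ (li F θ).A ∧ (li F θ).r ≤ H.r)) :
    S_N22 (RRec₁₃ 𝔯) := by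
  refine (YMDAG.N22.s_N22_rRec₁₃_w1_iff 𝔯 (fun F θ => ReadingData.ofRecordAdm F θ.τ9.M N (runTowers (S₀ F θ)) (sp F θ) (gauge F θ) (hg F θ) (T₀ F θ)
    (hT F θ) (li F θ)) hpin).2 fun F D h k => ?_
  have h18' := n18At_u3OfRecord₁₃_of_s_N18_rRec₁₃_pin 𝔯 (fun F θ => ReadingData.ofRecordAdm F θ.τ9.M N (runTowers (S₀ F θ)) (sp F θ) (gauge F θ) (hg F θ)
    (T₀ F θ) (hT F θ) (li F θ)) hpin h18 F D h
  obtain ⟨hC₀, hθ, hθ1, hC5, hC₀', hA, hθμ, hCM, hr, hs0, hs1, hμ1⟩ := hnum F h.params h.provisos h.admissible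
  obtain ⟨hMz, Sg, Rz, logZ, β, cs, c, L, hLz, a, a₂, a₂', a₅, Aabs, r₁, hspk, hL, hLc, hN, hA0, hr₁, hκ, hrate, hsmall, hrenew, hγc, hκc, h226TOnOlder, hE⟩ :=
    hdata F h.params h.provisos h.admissible k
  rw [u3OfRecord₁₃_eq_u3OfRecord₁₂]
  exact n22At_u3OfRecord₁₂_ofRecordAdm_runTowers_of_n18Below_termwise226OnOlder_eHoloAt (S₀ F h.params) (sp F h.params) (gauge F h.params) (hg F h.params)
    (T₀ F h.params) (hT F h.params) (li F h.params) h.params.toStage12Params k Sg Rz logZ β hspk c hL hLc hN hA0 hr₁ hκ hrate hsmall hrenew hγc hκc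
    h226TOnOlder hE (fun k' _ => by rw [← u3OfRecord₁₃_eq_u3OfRecord₁₂]; exact h18' k') hC5 hθ1 hC₀' hC₀ hθ hA hμ1 hθμ hCM hr h.gamma_pos hs0 hs1

end TowersEdge

/-! ## §2–§3 Twins of 19′ §4 and 21′ §3: generated towers, per-step ∕ per-term generator schemas -/

section GeneratedEdge

variable (Gn : (F : T4Family) → (θ : Stage13Params F N) → (k : ℕ) → GenTower (F.P k) (MatA N) θ.τ9.M)
  (sp : (F : T4Family) → (θ : Stage13Params F N) → (k j : ℕ) → (domSys (F.P k) θ.τ9.M j).Dom → Set (CPair (F.P k) (MatA N)))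
  (gauge : (F : T4Family) → (θ : Stage13Params F N) → (k : ℕ) → GaugeField (F.P k) 0 (Node00.SU N) → GaugeField (F.P k) 0 (Node00.SU N) → ℝ)
  (hg : ∀ (F : T4Family) (θ : Stage13Params F N) (k : ℕ) (U U' : GaugeField (F.P k) 0 (Node00.SU N)), 0 ≤ gauge F θ k U U')
  (T₀ : (F : T4Family) → (θ : Stage13Params F N) → (k : ℕ) → GaugeField (F.P (k + 1)) 0 (Node00.SU N) → GaugeField (F.P k) 0 (Node00.SU N))
  (hT : ∀ (F : T4Family) (θ : Stage13Params F N) (k : ℕ) (U : GaugeField (F.P (k + 1)) 0 (Node00.SU N)),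
    (∀ (j : ℕ) (Y : (domSys (F.P (k + 1)) θ.τ9.M j).Dom), ofBackgroundC (ιSU N) U ∈ sp F θ (k + 1) j Y) →
      ∀ (j : ℕ) (X : (domSys (F.P k) θ.τ9.M j).Dom), ofBackgroundC (ιSU N) (T₀ F θ k U) ∈ sp F θ k j X)
  (li : (F : T4Family) → Stage13Params F N → LetterInputs) {G : Type*} [GaugeGroup G]

open Classical in
/-- **STAGE-13 TWIN OF 19′ §4 — THE EDGE N18 → N22 AT A READING PINNED AT THE ADMISSIBLE READING OF RECORD ON THE GENERATED TOWERS OF THE RUNS OF RECORD, THREE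
SCHEMAS**: node N18's stub `S_N18 (RRec₁₃ 𝔯)` + the letter signs + per `(F, θ, k)` ∃(`NeZero θ.τ9.M`, `Sg`, `Rz`, `cs`, `c`, `L`, `NeZero L`, `a … r₁`): `hspk` ∧ numerals
∧ the THREE PER-STEP GENERATOR SCHEMAS at the steps `k′ < k` of `Gn F θ k` — (S-loc), (S-226) (node N10's lane), (S-last) (node N09's lane) ⟹ node N22's stub
`S_N22 (RRec₁₃ 𝔯)` — 19′ §3's engine at `θ.toStage12Params`. [cite: Balaban1987RG1, (0.23)-(0.25) pp.256-257, §1 p.263 and (2.12)-(2.13) p.268; Balaban1988RG2Cluster, (2.13)-(2.15) pp.14-15, (2.26) p.17 and (2.40)-(2.41) p.21] -/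
theorem s_N22_rRec₁₃_pin_ofRecordAdm_runTowers_toClusterTower_of_s_N18_threeSchemas
    (hpin : ∀ (F : T4Family) (θ : Stage13Params F N) (hP : θ.Provisos₁₃ F N) (g₀ : ℕ → ℝ) (os : List (ULoop F)), (𝔯.lit F θ hP g₀ os).u3 =
      (ReadingData.ofRecordAdm F θ.τ9.M N (runTowers fun k => toClusterTower (Gn F θ k)) (sp F θ) (gauge F θ) (hg F θ) (T₀ F θ) (hT F θ) (li F θ)).u3Objects θ.γ)
    (h18 : S_N18 (RRec₁₃ 𝔯))
    (hnum : ∀ (F : T4Family) (θ : Stage13Params F N), θ.Provisos₁₃ F N → θ.Admissible F N →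
      0 < (li F θ).C₀ ∧ 0 < (li F θ).θ₅ ∧ (li F θ).θ₅ < 1 ∧ 0 ≤ (li F θ).C₅ ∧ 2 * (li F θ).C₅ / (1 - (li F θ).θ₅) ≤ (li F θ).C₀ ∧ 0 < (li F θ).A ∧
        (li F θ).θ₅ ≤ (li F θ).μ ∧ (li F θ).C₀ ≤ 2 * (li F θ).A ∧ 0 < (li F θ).r ∧ 0 < (li F θ).s ∧ (li F θ).s < 1 ∧ 1 ≤ (li F θ).μ)
    (hdata : ∀ (F : T4Family) (θ : Stage13Params F N), θ.Provisos₁₃ F N → θ.Admissible F N → ∀ (k : ℕ),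
      ∃ (_ : NeZero θ.τ9.M) (Sg : Setting (MatA N) G) (Rz : Residual (F.P k) (MatA N))
        (cs : SFConsts) (c : B13.Consts) (L : ℕ) (_ : NeZero L) (a a₂ a₂' a₅ Aabs r₁ : ℝ),
        (∀ (j : ℕ) (Y : (domSys (F.P k) θ.τ9.M j).Dom), sp F θ k j Y ⊆ spaceI Sg Rz θ.τ9.M j (domSites (F.P k) θ.τ9.M j Y) cs.α₀ cs.α₁) ∧
        8 ≤ c.L ∧ c.L = L ∧ Lemma3Numerics c θ.τ9.M ((c.L : ℝ) / 2) a a₂ a₂' a₅ Aabs ∧ 0 ≤ c.C3act * c.ε₁ ∧ 0 ≤ r₁ ∧ (li F θ).κ ≤ r₁ ∧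
        r₁ + 2 * (64 * Real.log 162) + 2 ≤ (1 - 8 * c.δ) * ((c.L : ℝ) / 2) * c.κ ∧
        c.C3act * c.ε₁ * Real.exp (5 * r₁ + 1) * K₀ 64 8 * 9 * 64 ≤ 1 ∧
        Real.exp 1 * 9 * 64 * K₀ 64 8 ^ 2 * (c.C3act * c.ε₁) ≤ (li F θ).A ∧
        (∀ (k' : ℕ), k' < k → ∀ (t : ℂ) (old old' : OlderTerms (F.P k) (MatA N) θ.τ9.M k') (φ : CPair (F.P k) (MatA N))
          (Z : (domSys (F.P k) θ.τ9.M (k' + 1)).Dom),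
          (∀ (j : Fin (k' + 1)) (Y : (domSys (F.P k) θ.τ9.M j).Dom) (ψ : CPair (F.P k) (MatA N)),
            ψ ∈ spaceI Sg Rz θ.τ9.M j (domSites (F.P k) θ.τ9.M j Y) cs.α₀ cs.α₁ → old j Y ψ = old' j Y ψ) →
          (Gn F θ k k').H t old φ Z = (Gn F θ k k').H t old' φ Z) ∧
        (∀ (k' : ℕ), k' < k → ∀ (D : Set ℂ), IsOpen D → (∀ t ∈ Ioc (0 : ℝ) θ.γ, closedBall (t : ℂ) (li F θ).r ⊆ D) →
          ∀ (s : ℝ), s ∈ Ioc (0 : ℝ) θ.γ → ∀ (cv : ℂ → OlderTerms (F.P k) (MatA N) θ.τ9.M k'),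
          (∀ (j : Fin (k' + 1)) (Y : (domSys (F.P k) θ.τ9.M j).Dom) (ψ : CPair (F.P k) (MatA N)),
            ψ ∈ spaceI Sg Rz θ.τ9.M j (domSites (F.P k) θ.τ9.M j Y) cs.α₀ cs.α₁ →
            DifferentiableOn ℂ (fun z => cv z j Y ψ) D ∧ ∀ z ∈ D, ‖cv z j Y ψ‖ ≤ (li F θ).A * Real.exp (-((li F θ).κ * torusTreeLen Y.1))) →
          ∀ (X : (domSys (F.P k) θ.τ9.M (k' + 1)).Dom) (φ : CPair (F.P k) (MatA N)),
          φ ∈ spaceI Sg Rz θ.τ9.M (k' + 1) (domSites (F.P k) θ.τ9.M (k' + 1) X) cs.α₀ cs.α₁ →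
          ∃ Tt : (Z : TDom 4 (domCount (F.P k) θ.τ9.M (k' + 1))) →
              Finset (TDom 4 (L * domCount (F.P k) θ.τ9.M (k' + 1))) × Finset (TBond 4 θ.τ9.M (L * domCount (F.P k) θ.τ9.M (k' + 1))) → ℂ → ℂ,
            (∀ Z : (domSys (F.P k) θ.τ9.M (k' + 1)).Dom, Z.1 ⊆ X.1 → DifferentiableOn ℂ (fun z => (Gn F θ k k').H (s : ℂ) (cv z) φ Z) D) ∧
            (∀ z ∈ D, ∀ Z : TDom 4 (domCount (F.P k) θ.τ9.M (k' + 1)), Z.1 ⊆ X.1 →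
              ‖(Gn F θ k k').H (s : ℂ) (cv z) φ Z‖ ≤ ∑ t ∈ terms L θ.τ9.M Z, ‖Tt Z t z‖) ∧
            (∀ z ∈ D, ∀ Z : TDom 4 (domCount (F.P k) θ.τ9.M (k' + 1)), Z.1 ⊆ X.1 → ∀ t ∈ terms L θ.τ9.M Z,
              ‖Tt Z t z‖ ≤ weight L θ.τ9.M c Z a t * Real.exp (a₅ * ((Z.1).card : ℝ)))) ∧
        (∀ (k' : ℕ), k' < k → ∀ (old : OlderTerms (F.P k) (MatA N) θ.τ9.M k'), ∃ U : Set ℂ, IsOpen U ∧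
          (∀ t ∈ Ioc (0 : ℝ) θ.γ, closedBall (t : ℂ) (li F θ).r ⊆ U) ∧
          ((∀ (j : Fin (k' + 1)) (Y : (domSys (F.P k) θ.τ9.M j).Dom) (ψ : CPair (F.P k) (MatA N)),
              ψ ∈ spaceI Sg Rz θ.τ9.M j (domSites (F.P k) θ.τ9.M j Y) cs.α₀ cs.α₁ → ‖old j Y ψ‖ ≤ (li F θ).A * Real.exp (-((li F θ).κ * torusTreeLen Y.1))) →
            ∀ (X : (domSys (F.P k) θ.τ9.M (k' + 1)).Dom) (φ : CPair (F.P k) (MatA N)),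
            φ ∈ spaceI Sg Rz θ.τ9.M (k' + 1) (domSites (F.P k) θ.τ9.M (k' + 1) X) cs.α₀ cs.α₁ →
            DifferentiableOn ℂ (fun z => (Gn F θ k k').E z old φ X) U ∧
              ∀ z ∈ U, ‖(Gn F θ k k').E z old φ X‖ ≤ (li F θ).A * Real.exp (-((li F θ).κ * torusTreeLen X.1))))) :
    S_N22 (RRec₁₃ 𝔯) := by
  refine (YMDAG.N22.s_N22_rRec₁₃_w1_iff 𝔯 (fun F θ => ReadingData.ofRecordAdm F θ.τ9.M N (runTowers fun k => toClusterTower (Gn F θ k)) (sp F θ) (gauge F θ)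
    (hg F θ) (T₀ F θ) (hT F θ) (li F θ)) hpin).2 fun F D h k => ?_
  have h18' := n18At_u3OfRecord₁₃_of_s_N18_rRec₁₃_pin 𝔯 (fun F θ => ReadingData.ofRecordAdm F θ.τ9.M N (runTowers fun k => toClusterTower (Gn F θ k)) (sp F θ)
    (gauge F θ) (hg F θ) (T₀ F θ) (hT F θ) (li F θ)) hpin h18 F D h
  obtain ⟨hC₀, hθ, hθ1, hC5, hC₀', hA, hθμ, hCM, hr, hs0, hs1, hμ1⟩ := hnum F h.params h.provisos h.admissible
  obtain ⟨hMz, Sg, Rz, cs, c, L, hLz, a, a₂, a₂', a₅, Aabs, r₁, hspk, hL, hLc, hN, hA0, hr₁, hκ, hrate, hsmall, hrenew, hloc, h226G, hlastG⟩ :=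
    hdata F h.params h.provisos h.admissible k
  rw [u3OfRecord₁₃_eq_u3OfRecord₁₂]
  exact n22At_u3OfRecord₁₂_ofRecordAdm_runTowers_toClusterTower_of_n18Below_threeSchemas (Gn F h.params) (sp F h.params) (gauge F h.params) (hg F h.params)
    (T₀ F h.params) (hT F h.params) (li F h.params) h.params.toStage12Params k Sg Rz hspk c hL hLc hN hA0 hr₁ hκ hrate hsmall hrenew hloc h226G hlastG
    (fun k' _ => by rw [← u3OfRecord₁₃_eq_u3OfRecord₁₂]; exact h18' k') hC5 hθ1 hC₀' hC₀ hθ hA hμ1 hθμ hCM hr h.gamma_pos hs0 hs1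

open Classical in
/-- **STAGE-13 TWIN OF 21′ §3 — THE EDGE N18 → N22 AT A READING PINNED AT THE ADMISSIBLE READING OF RECORD ON THE GENERATED TOWERS OF THE RUNS OF RECORD, ALL
ANALYTIC INPUTS AT TERM LEVEL**: node N18's stub `S_N18 (RRec₁₃ 𝔯)` + the letter signs + per `(F, θ, k)` ∃(`NeZero θ.τ9.M`, `Sg`, `Rz`, `cs`, `c`, `L`, `NeZero L`,
`a … r₁`, index maps `e`): `hspk` ∧ numerals ∧ (S-loc)_{k′<k} ∧ (`e` into `terms`, injective on `idx`) ∧ (S-226-T)_{k′<k} ([II] (2.26) per term with COMPLEX OLDER TERMS,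
node N10) ∧ (S-last-T)_{k′<k} ([II] (2.26) per term with COMPLEX LAST COUPLING given (1.18)-size of the real older terms, node N09) ⟹ node N22's stub `S_N22 (RRec₁₃ 𝔯)` —
the three-schemas twin with (S-226) ∕ (S-last) supplied by 20′ §1 `stepSchema226_of_termwise` ∕ 21′ §2 `stepSchemaLast_of_termwiseIdx`. [cite: Balaban1988RG2Cluster, (2.9)-(2.15) pp.14-15, (2.26) p.17, Lemma 3 p.20 and (2.39)-(2.41) p.21; Balaban1987RG1, §1 p.263 and (2.12)-(2.13) p.268] -/
theorem s_N22_rRec₁₃_pin_ofRecordAdm_runTowers_toClusterTower_of_s_N18_allTermwise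
    (hpin : ∀ (F : T4Family) (θ : Stage13Params F N) (hP : θ.Provisos₁₃ F N) (g₀ : ℕ → ℝ) (os : List (ULoop F)), (𝔯.lit F θ hP g₀ os).u3 =
      (ReadingData.ofRecordAdm F θ.τ9.M N (runTowers fun k => toClusterTower (Gn F θ k)) (sp F θ) (gauge F θ) (hg F θ) (T₀ F θ) (hT F θ) (li F θ)).u3Objects θ.γ)
    (h18 : S_N18 (RRec₁₃ 𝔯))
    (hnum : ∀ (F : T4Family) (θ : Stage13Params F N), θ.Provisos₁₃ F N → θ.Admissible F N →
      0 < (li F θ).C₀ ∧ 0 < (li F θ).θ₅ ∧ (li F θ).θ₅ < 1 ∧ 0 ≤ (li F θ).C₅ ∧ 2 * (li F θ).C₅ / (1 - (li F θ).θ₅) ≤ (li F θ).C₀ ∧ 0 < (li F θ).A ∧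
        (li F θ).θ₅ ≤ (li F θ).μ ∧ (li F θ).C₀ ≤ 2 * (li F θ).A ∧ 0 < (li F θ).r ∧ 0 < (li F θ).s ∧ (li F θ).s < 1 ∧ 1 ≤ (li F θ).μ)
    (hdata : ∀ (F : T4Family) (θ : Stage13Params F N), θ.Provisos₁₃ F N → θ.Admissible F N → ∀ (k : ℕ),
      ∃ (_ : NeZero θ.τ9.M) (Sg : Setting (MatA N) G) (Rz : Residual (F.P k) (MatA N))
        (cs : SFConsts) (c : B13.Consts) (L : ℕ) (_ : NeZero L) (a a₂ a₂' a₅ Aabs r₁ : ℝ)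
        (e : (k' : ℕ) → (Z : (domSys (F.P k) θ.τ9.M (k' + 1)).Dom) → (Gn F θ k k').Idx →
          Finset (TDom 4 (L * domCount (F.P k) θ.τ9.M (k' + 1))) × Finset (TBond 4 θ.τ9.M (L * domCount (F.P k) θ.τ9.M (k' + 1)))),
        (∀ (j : ℕ) (Y : (domSys (F.P k) θ.τ9.M j).Dom), sp F θ k j Y ⊆ spaceI Sg Rz θ.τ9.M j (domSites (F.P k) θ.τ9.M j Y) cs.α₀ cs.α₁) ∧
        8 ≤ c.L ∧ c.L = L ∧ Lemma3Numerics c θ.τ9.M ((c.L : ℝ) / 2) a a₂ a₂' a₅ Aabs ∧ 0 ≤ c.C3act * c.ε₁ ∧ 0 ≤ r₁ ∧ (li F θ).κ ≤ r₁ ∧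
        r₁ + 2 * (64 * Real.log 162) + 2 ≤ (1 - 8 * c.δ) * ((c.L : ℝ) / 2) * c.κ ∧
        c.C3act * c.ε₁ * Real.exp (5 * r₁ + 1) * K₀ 64 8 * 9 * 64 ≤ 1 ∧
        Real.exp 1 * 9 * 64 * K₀ 64 8 ^ 2 * (c.C3act * c.ε₁) ≤ (li F θ).A ∧
        (∀ (k' : ℕ), k' < k → ∀ (t : ℂ) (old old' : OlderTerms (F.P k) (MatA N) θ.τ9.M k') (φ : CPair (F.P k) (MatA N))
          (Z : (domSys (F.P k) θ.τ9.M (k' + 1)).Dom),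
          (∀ (j : Fin (k' + 1)) (Y : (domSys (F.P k) θ.τ9.M j).Dom) (ψ : CPair (F.P k) (MatA N)),
            ψ ∈ spaceI Sg Rz θ.τ9.M j (domSites (F.P k) θ.τ9.M j Y) cs.α₀ cs.α₁ → old j Y ψ = old' j Y ψ) →
          (Gn F θ k k').H t old φ Z = (Gn F θ k k').H t old' φ Z) ∧
        (∀ (k' : ℕ), k' < k → ∀ (Z : (domSys (F.P k) θ.τ9.M (k' + 1)).Dom), ∀ i ∈ (Gn F θ k k').idx Z, e k' Z i ∈ terms L θ.τ9.M Z) ∧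
        (∀ (k' : ℕ), k' < k → ∀ (Z : (domSys (F.P k) θ.τ9.M (k' + 1)).Dom), Set.InjOn (e k' Z) ((Gn F θ k k').idx Z)) ∧
        (∀ (k' : ℕ), k' < k → ∀ (D : Set ℂ), IsOpen D → (∀ t ∈ Ioc (0 : ℝ) θ.γ, closedBall (t : ℂ) (li F θ).r ⊆ D) →
          ∀ (s : ℝ), s ∈ Ioc (0 : ℝ) θ.γ → ∀ (cv : ℂ → OlderTerms (F.P k) (MatA N) θ.τ9.M k'),
          (∀ (j : Fin (k' + 1)) (Y : (domSys (F.P k) θ.τ9.M j).Dom) (ψ : CPair (F.P k) (MatA N)),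
            ψ ∈ spaceI Sg Rz θ.τ9.M j (domSites (F.P k) θ.τ9.M j Y) cs.α₀ cs.α₁ →
            DifferentiableOn ℂ (fun z => cv z j Y ψ) D ∧ ∀ z ∈ D, ‖cv z j Y ψ‖ ≤ (li F θ).A * Real.exp (-((li F θ).κ * torusTreeLen Y.1))) →
          ∀ (X : (domSys (F.P k) θ.τ9.M (k' + 1)).Dom) (φ : CPair (F.P k) (MatA N)),
          φ ∈ spaceI Sg Rz θ.τ9.M (k' + 1) (domSites (F.P k) θ.τ9.M (k' + 1) X) cs.α₀ cs.α₁ →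
          ∀ (Z : (domSys (F.P k) θ.τ9.M (k' + 1)).Dom), Z.1 ⊆ X.1 → ∀ i ∈ (Gn F θ k k').idx Z,
            DifferentiableOn ℂ (fun z => (Gn F θ k k').T i (s : ℂ) (cv z) φ) D ∧
            ∀ z ∈ D, ‖(Gn F θ k k').T i (s : ℂ) (cv z) φ‖ ≤ weight L θ.τ9.M c Z a (e k' Z i) * Real.exp (a₅ * ((Z.1).card : ℝ))) ∧
        (∀ (k' : ℕ), k' < k → ∀ (old : OlderTerms (F.P k) (MatA N) θ.τ9.M k'), ∃ U : Set ℂ, IsOpen U ∧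
          (∀ t ∈ Ioc (0 : ℝ) θ.γ, closedBall (t : ℂ) (li F θ).r ⊆ U) ∧
          ((∀ (j : Fin (k' + 1)) (Y : (domSys (F.P k) θ.τ9.M j).Dom) (ψ : CPair (F.P k) (MatA N)),
              ψ ∈ spaceI Sg Rz θ.τ9.M j (domSites (F.P k) θ.τ9.M j Y) cs.α₀ cs.α₁ → ‖old j Y ψ‖ ≤ (li F θ).A * Real.exp (-((li F θ).κ * torusTreeLen Y.1))) →
            ∀ (X : (domSys (F.P k) θ.τ9.M (k' + 1)).Dom) (φ : CPair (F.P k) (MatA N)),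
            φ ∈ spaceI Sg Rz θ.τ9.M (k' + 1) (domSites (F.P k) θ.τ9.M (k' + 1) X) cs.α₀ cs.α₁ →
            ∀ (Z : (domSys (F.P k) θ.τ9.M (k' + 1)).Dom), Z.1 ⊆ X.1 → ∀ i ∈ (Gn F θ k k').idx Z,
              DifferentiableOn ℂ (fun z => (Gn F θ k k').T i z old φ) U ∧
              ∀ z ∈ U, ‖(Gn F θ k k').T i z old φ‖ ≤ weight L θ.τ9.M c Z a (e k' Z i) * Real.exp (a₅ * ((Z.1).card : ℝ))))) :
    S_N22 (RRec₁₃ 𝔯) := by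
  refine s_N22_rRec₁₃_pin_ofRecordAdm_runTowers_toClusterTower_of_s_N18_threeSchemas 𝔯 (G := G) Gn sp gauge hg T₀ hT li hpin h18 hnum
    fun F θ hP hθ k => ?_
  obtain ⟨hMz, Sg, Rz, cs, c, L, hLz, a, a₂, a₂', a₅, Aabs, r₁, e, hspk, hL, hLc, hN, hA0, hr₁, hκ, hrate, hsmall, hrenew, hloc, he, hinj, h226T,
    hlastTi⟩ := hdata F θ hP hθ k
  exact ⟨hMz, Sg, Rz, cs, c, L, hLz, a, a₂, a₂', a₅, Aabs, r₁, hspk, hL, hLc, hN, hA0, hr₁, hκ, hrate, hsmall, hrenew, hloc,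
    fun k' hk => stepSchema226_of_termwise k Sg Rz (Gn F θ k k') c (mul_nonneg hN.hα₆.le hN.hε₀) (e k') (he k' hk) (hinj k' hk) (h226T k' hk),
    stepSchemaLast_of_termwiseIdx k Sg Rz (Gn F θ k) k c hL hLc hN hA0 hr₁ hκ hrate hsmall hrenew e he hinj hlastTi⟩

end GeneratedEdge

/-! ## §4 (v1.1) Twin of 16′ §3: generated towers, (S-loc) + (S-226) per step + node N09's `EHoloAt` family below the run length (dag-n27-c XXXV's N22 slot at ₁₃) -/

section GeneratedEdgeEHolo

variable (Gn : (F : T4Family) → (θ : Stage13Params F N) → (k : ℕ) → GenTower (F.P k) (MatA N) θ.τ9.M)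
  (sp : (F : T4Family) → (θ : Stage13Params F N) → (k j : ℕ) → (domSys (F.P k) θ.τ9.M j).Dom → Set (CPair (F.P k) (MatA N)))
  (gauge : (F : T4Family) → (θ : Stage13Params F N) → (k : ℕ) → GaugeField (F.P k) 0 (Node00.SU N) → GaugeField (F.P k) 0 (Node00.SU N) → ℝ)
  (hg : ∀ (F : T4Family) (θ : Stage13Params F N) (k : ℕ) (U U' : GaugeField (F.P k) 0 (Node00.SU N)), 0 ≤ gauge F θ k U U')
  (T₀ : (F : T4Family) → (θ : Stage13Params F N) → (k : ℕ) → GaugeField (F.P (k + 1)) 0 (Node00.SU N) → GaugeField (F.P k) 0 (Node00.SU N))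
  (hT : ∀ (F : T4Family) (θ : Stage13Params F N) (k : ℕ) (U : GaugeField (F.P (k + 1)) 0 (Node00.SU N)),
    (∀ (j : ℕ) (Y : (domSys (F.P (k + 1)) θ.τ9.M j).Dom), ofBackgroundC (ιSU N) U ∈ sp F θ (k + 1) j Y) →
      ∀ (j : ℕ) (X : (domSys (F.P k) θ.τ9.M j).Dom), ofBackgroundC (ιSU N) (T₀ F θ k U) ∈ sp F θ k j X)
  (li : (F : T4Family) → Stage13Params F N → LetterInputs) {G : Type*} [GaugeGroup G]

open Classical in
/-- **STAGE-13 TWIN OF 16′ §3 — THE EDGE N18 → N22 AT A READING PINNED AT THE ADMISSIBLE READING OF RECORD ON THE GENERATED TOWERS OF THE RUNS OF RECORD, PER-STEP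
GENERATOR SCHEMAS + `EHoloAt` FAMILY** (v1.1, asked by dag-n27-c's successor trigger for its module XXXV at ₁₃): node N18's stub `S_N18 (RRec₁₃ 𝔯)` + the letter signs + per
`(F, θ, k)` ∃(`NeZero θ.τ9.M`, `Sg`, `Rz`, `logZ`, `β`, `cs`, `c`, `L`, `NeZero L`, `a … r₁`): `hspk` ∧ numerals ∧ `θ.γ ≤ cs.γ` ∧ `li.κ ≤ cs.κ` ∧ (S-loc)_{k′<k} ∧ (S-226)_{k′<k}
for `Gn F θ k` (node N10's lane, generator language) ∧ node N09's `EHoloAt` family on `sfTowerOfRecord Sg Rz θ.τ9.M (toClusterTower (Gn F θ k)) ⟨g, β⟩ logZ` below the run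
length ⟹ node N22's stub `S_N22 (RRec₁₃ 𝔯)` — §1 at `S₀ F θ k := toClusterTower (Gn F θ k)` with 16′ §1 `termwise226OnOlder_toClusterTower_of_stepSchemas`.
[cite: Balaban1987RG1, (0.23)-(0.25) pp.256-257, (1.18) p.263 and (2.12)-(2.13) p.268; Balaban1988RG2Cluster, (2.13)-(2.15) pp.14-15, (2.26) p.17 and (2.40)-(2.41) p.21] -/
theorem s_N22_rRec₁₃_pin_ofRecordAdm_runTowers_toClusterTower_of_s_N18_stepSchemas_eHoloAt
    (hpin : ∀ (F : T4Family) (θ : Stage13Params F N) (hP : θ.Provisos₁₃ F N) (g₀ : ℕ → ℝ) (os : List (ULoop F)), (𝔯.lit F θ hP g₀ os).u3 =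
      (ReadingData.ofRecordAdm F θ.τ9.M N (runTowers fun k => toClusterTower (Gn F θ k)) (sp F θ) (gauge F θ) (hg F θ) (T₀ F θ) (hT F θ) (li F θ)).u3Objects θ.γ)
    (h18 : S_N18 (RRec₁₃ 𝔯))
    (hnum : ∀ (F : T4Family) (θ : Stage13Params F N), θ.Provisos₁₃ F N → θ.Admissible F N →
      0 < (li F θ).C₀ ∧ 0 < (li F θ).θ₅ ∧ (li F θ).θ₅ < 1 ∧ 0 ≤ (li F θ).C₅ ∧ 2 * (li F θ).C₅ / (1 - (li F θ).θ₅) ≤ (li F θ).C₀ ∧ 0 < (li F θ).A ∧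
        (li F θ).θ₅ ≤ (li F θ).μ ∧ (li F θ).C₀ ≤ 2 * (li F θ).A ∧ 0 < (li F θ).r ∧ 0 < (li F θ).s ∧ (li F θ).s < 1 ∧ 1 ≤ (li F θ).μ)
    (hdata : ∀ (F : T4Family) (θ : Stage13Params F N), θ.Provisos₁₃ F N → θ.Admissible F N → ∀ (k : ℕ),
      ∃ (_ : NeZero θ.τ9.M) (Sg : Setting (MatA N) G) (Rz : Residual (F.P k) (MatA N)) (logZ : ℕ → GaugeField (F.P k) 0 G → ℝ) (β : ℕ → ℝ → ℝ)
        (cs : SFConsts) (c : B13.Consts) (L : ℕ) (_ : NeZero L) (a a₂ a₂' a₅ Aabs r₁ : ℝ),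
        (∀ (j : ℕ) (Y : (domSys (F.P k) θ.τ9.M j).Dom), sp F θ k j Y ⊆ spaceI Sg Rz θ.τ9.M j (domSites (F.P k) θ.τ9.M j Y) cs.α₀ cs.α₁) ∧
        8 ≤ c.L ∧ c.L = L ∧ Lemma3Numerics c θ.τ9.M ((c.L : ℝ) / 2) a a₂ a₂' a₅ Aabs ∧ 0 ≤ c.C3act * c.ε₁ ∧ 0 ≤ r₁ ∧ (li F θ).κ ≤ r₁ ∧
        r₁ + 2 * (64 * Real.log 162) + 2 ≤ (1 - 8 * c.δ) * ((c.L : ℝ) / 2) * c.κ ∧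
        c.C3act * c.ε₁ * Real.exp (5 * r₁ + 1) * K₀ 64 8 * 9 * 64 ≤ 1 ∧
        Real.exp 1 * 9 * 64 * K₀ 64 8 ^ 2 * (c.C3act * c.ε₁) ≤ (li F θ).A ∧ θ.γ ≤ cs.γ ∧ (li F θ).κ ≤ cs.κ ∧
        (∀ (k' : ℕ), k' < k → ∀ (t : ℂ) (old old' : OlderTerms (F.P k) (MatA N) θ.τ9.M k') (φ : CPair (F.P k) (MatA N))
          (Z : (domSys (F.P k) θ.τ9.M (k' + 1)).Dom),
          (∀ (j : Fin (k' + 1)) (Y : (domSys (F.P k) θ.τ9.M j).Dom) (ψ : CPair (F.P k) (MatA N)),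
            ψ ∈ spaceI Sg Rz θ.τ9.M j (domSites (F.P k) θ.τ9.M j Y) cs.α₀ cs.α₁ → old j Y ψ = old' j Y ψ) →
          (Gn F θ k k').H t old φ Z = (Gn F θ k k').H t old' φ Z) ∧
        (∀ (k' : ℕ), k' < k → ∀ (D : Set ℂ), IsOpen D → (∀ t ∈ Ioc (0 : ℝ) θ.γ, closedBall (t : ℂ) (li F θ).r ⊆ D) →
          ∀ (s : ℝ), s ∈ Ioc (0 : ℝ) θ.γ → ∀ (cv : ℂ → OlderTerms (F.P k) (MatA N) θ.τ9.M k'),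
          (∀ (j : Fin (k' + 1)) (Y : (domSys (F.P k) θ.τ9.M j).Dom) (ψ : CPair (F.P k) (MatA N)),
            ψ ∈ spaceI Sg Rz θ.τ9.M j (domSites (F.P k) θ.τ9.M j Y) cs.α₀ cs.α₁ →
            DifferentiableOn ℂ (fun z => cv z j Y ψ) D ∧ ∀ z ∈ D, ‖cv z j Y ψ‖ ≤ (li F θ).A * Real.exp (-((li F θ).κ * torusTreeLen Y.1))) →
          ∀ (X : (domSys (F.P k) θ.τ9.M (k' + 1)).Dom) (φ : CPair (F.P k) (MatA N)),
          φ ∈ spaceI Sg Rz θ.τ9.M (k' + 1) (domSites (F.P k) θ.τ9.M (k' + 1) X) cs.α₀ cs.α₁ →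
          ∃ Tt : (Z : TDom 4 (domCount (F.P k) θ.τ9.M (k' + 1))) →
              Finset (TDom 4 (L * domCount (F.P k) θ.τ9.M (k' + 1))) × Finset (TBond 4 θ.τ9.M (L * domCount (F.P k) θ.τ9.M (k' + 1))) → ℂ → ℂ,
            (∀ Z : (domSys (F.P k) θ.τ9.M (k' + 1)).Dom, Z.1 ⊆ X.1 → DifferentiableOn ℂ (fun z => (Gn F θ k k').H (s : ℂ) (cv z) φ Z) D) ∧
            (∀ z ∈ D, ∀ Z : TDom 4 (domCount (F.P k) θ.τ9.M (k' + 1)), Z.1 ⊆ X.1 →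
              ‖(Gn F θ k k').H (s : ℂ) (cv z) φ Z‖ ≤ ∑ t ∈ terms L θ.τ9.M Z, ‖Tt Z t z‖) ∧
            (∀ z ∈ D, ∀ Z : TDom 4 (domCount (F.P k) θ.τ9.M (k' + 1)), Z.1 ⊆ X.1 → ∀ t ∈ terms L θ.τ9.M Z,
              ‖Tt Z t z‖ ≤ weight L θ.τ9.M c Z a t * Real.exp (a₅ * ((Z.1).card : ℝ)))) ∧
        (∀ g ∈ Window θ.γ, ∀ k' : ℕ, k' + 1 ≤ k →
          ∃ H : EHoloAt (sfTowerOfRecord Sg Rz θ.τ9.M (toClusterTower (Gn F θ k)) ⟨g, β⟩ logZ) cs k', H.E₀ ≤ (li F θ).A ∧ (li F θ).r ≤ H.r)) :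
    S_N22 (RRec₁₃ 𝔯) := by
  refine s_N22_rRec₁₃_pin_ofRecordAdm_runTowers_of_s_N18_termwise226OnOlder_eHoloAt 𝔯 (G := G) (fun F θ k => toClusterTower (Gn F θ k)) sp gauge hg T₀ hT li
    hpin h18 hnum fun F θ hP hθ k => ?_
  obtain ⟨hMz, Sg, Rz, logZ, β, cs, c, L, hLz, a, a₂, a₂', a₅, Aabs, r₁, hspk, hL, hLc, hN, hA0, hr₁, hκ, hrate, hsmall, hrenew, hγc, hκc, hloc, h226G, hE⟩ :=
    hdata F θ hP hθ k
  exact ⟨hMz, Sg, Rz, logZ, β, cs, c, L, hLz, a, a₂, a₂', a₅, Aabs, r₁, hspk, hL, hLc, hN, hA0, hr₁, hκ, hrate, hsmall, hrenew, hγc, hκc,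
    termwise226OnOlder_toClusterTower_of_stepSchemas k Sg Rz (Gn F θ k) k c hloc h226G, hE⟩

end GeneratedEdgeEHolo

end YMDAG.N22.W1

end
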